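import Summits.Ventures.YMGap.Thresholds.OneLinkRemainderGradient
import HarnessLib

/-!
# Venture YMGap — the one-link modulus beyond first order, part 43: the NON-LINEAR PART `c₃'` of the cubic remainder —
# derivative and gradient bounds, the split identity, and the matrix of the linear part (inputs of the linear bootstrap)

HONEST FRAMING: venture file of the cell `pub-ymgap` (QuantumFields programme), strong-coupling LATTICE bookkeeping for `SU(N)`
lattice Yang–Mills; nothing about the continuum or the mass gap in the Clay sense.  Pure matrix calculus, no measure, no number of
record (cell note `HOME/p2/ONE-LINK-HIERARCHY.md` §15 (1)).

WHAT.  The eight-term cubic remainder `c₃ = Γ(Re tr(·B), ψ₂)` (`OneLinkRemainderIdentity.gam_potB_psiTwo_eq`) is the sum of a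
five-term NON-LINEAR part `c₃'` (terms `T_a, T_c, T_d1, T_d2, T_d5`) and a LINEAR statistic `Re tr(·M_ℓ)`
(`T_b + T_d3 + T_d4`; `M_ℓ = −(κ_w/2)(BBᴴΔ + ΔBᴴB) + ½η·Δ + ½α·B`, `η = κ_t tr(BBᴴ) − c·conj tr(BBᴴ)`, `α = κ_tτ − c τ̄`, `τ = tr(ΔBᴴ)`).
* `abs_matD_c3prime_le`: `|D_A c₃'(g)| ≤ P'(g)‖A‖_F` with `P' = P − (linear terms)` (`3κ_w r²‖Δ‖_F` in place of `4κ_w r²‖Δ‖_F`, no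
  `‖B‖_F²‖Δ‖_F` constants), term by term from `OneLinkCubicWords` / `OneLinkRemainderWords`;
* `Gam_c3prime_le`: `Γ(c₃', c₃')(g) ≤ P'(g)²` (frame trick);
* `c3_split`: ON `SU(N)`, `Δ_LB ψ₂ + NΓ(Re tr(·B), Re tr(·Δ)) + NΓ(Re tr(·B), ψ₂) = (N−1/N)/2·Re tr(BΔᴴ) + Re tr(·(N M_ℓ)) + N c₃'`
  — the hypothesis `hdec` of `OneLinkPoissonCovarianceSplit.cov_linear_le_of_poisson_split`;
* `frobNorm_linPart_le`: `‖N M_ℓ‖_F ≤ N ‖Δ‖_F (κ_w ‖B‖_op² + κ_t ‖B‖_F²)` (`≤ (3E/2) N r² ‖Δ‖_F` at `‖B‖_F ≤ √N r`).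

References: cell note `HOME/p2/ONE-LINK-HIERARCHY.md` §3 (the eight terms), §15 (1).
-/

noncomputable section

open scoped Matrix ComplexConjugate BigOperators
open Matrix Complex Finset
open Literature.MathematicalPhysics.QuantumFieldTheory
open Literature.MathematicalPhysics.QuantumFieldTheory.SUNBakryEmery

namespace Summit.Ventures.YMGap.OneLinkEigen

variable {N : ℕ}

section Calc

open scoped Matrix.Norms.Frobenius ContDiff Topology

/-- **`|D_A c₃'(g)| ≤ P'(g) ‖A‖_F`** on `SU(N)`, `N ≥ 3`, for the five-term non-linear part `c₃'` of the cubic remainder. [folklore] -/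
theorem abs_matD_c3prime_le (hN : 3 ≤ N) (B Δ A : Matrix (Fin N) (Fin N) ℂ) (g : SUN N) :
    |matD A (fun Q : Matrix (Fin N) (Fin N) ℂ =>
      ((N : ℝ) ^ 2 / (4 * ((N : ℝ) ^ 2 - 4))) / 2 *
          ((Q * B * Q * Δ * Q * B).trace.re + (Q * B * Q * B * Q * Δ).trace.re)
        + 2 * ((N : ℝ) ^ 2 / (4 * ((N : ℝ) ^ 2 - 4))) / N * (Q * B).trace.im * (Q * Δ * Q * B).trace.im
        - 1 / 2 * ((Q * B * Q * B).trace *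
            ((((N : ℝ) / (2 * ((N : ℝ) ^ 2 - 4)) : ℝ) : ℂ) * (Q * Δ).trace
              - ((1 / (4 * (N : ℝ)) : ℝ) : ℂ) * (starRingEnd ℂ) (Q * Δ).trace)).re
        - 1 / 2 * ((Q * Δ * Q * B).trace *
            ((((N : ℝ) / (2 * ((N : ℝ) ^ 2 - 4)) : ℝ) : ℂ) * (Q * B).trace
              - ((1 / (4 * (N : ℝ)) : ℝ) : ℂ) * (starRingEnd ℂ) (Q * B).trace)).re
        - 2 * ((N : ℝ) / (2 * ((N : ℝ) ^ 2 - 4))) / N *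
          (Q * B).trace.im * ((Q * B).trace * (Q * Δ).trace).im) g| ≤
      (3 * ((N : ℝ) ^ 2 / (4 * ((N : ℝ) ^ 2 - 4))) * matrixOpNorm B ^ 2 * frobNorm Δ
        + 2 * ((N : ℝ) ^ 2 / (4 * ((N : ℝ) ^ 2 - 4))) / N *
          (2 * matrixOpNorm B * frobNorm Δ * |((g : Matrix (Fin N) (Fin N) ℂ) * B).trace.im|
            + frobNorm B * ‖((g : Matrix (Fin N) (Fin N) ℂ) * Δ * g * B).trace‖)
        + 1 / 2 * (((N : ℝ) / (2 * ((N : ℝ) ^ 2 - 4))) + 1 / (4 * (N : ℝ))) *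
          (2 * matrixOpNorm B * frobNorm B * ‖((g : Matrix (Fin N) (Fin N) ℂ) * Δ).trace‖
            + frobNorm Δ * ‖((g : Matrix (Fin N) (Fin N) ℂ) * B * g * B).trace‖)
        + 1 / 2 * (((N : ℝ) / (2 * ((N : ℝ) ^ 2 - 4))) + 1 / (4 * (N : ℝ))) *
          (2 * matrixOpNorm B * frobNorm Δ * ‖((g : Matrix (Fin N) (Fin N) ℂ) * B).trace‖
            + frobNorm B * ‖((g : Matrix (Fin N) (Fin N) ℂ) * Δ * g * B).trace‖)
        + 2 * ((N : ℝ) / (2 * ((N : ℝ) ^ 2 - 4))) / N *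
          (frobNorm B * |((g : Matrix (Fin N) (Fin N) ℂ) * B).trace.im| * ‖((g : Matrix (Fin N) (Fin N) ℂ) * Δ).trace‖
            + frobNorm Δ * |((g : Matrix (Fin N) (Fin N) ℂ) * B).trace.im| * ‖((g : Matrix (Fin N) (Fin N) ℂ) * B).trace‖
            + frobNorm B * ‖((g : Matrix (Fin N) (Fin N) ℂ) * B).trace‖ * ‖((g : Matrix (Fin N) (Fin N) ℂ) * Δ).trace‖))
        * frobNorm A := by
  have hN0 : N ≠ 0 := by omega
  have h3 : (3 : ℝ) ≤ N := by exact_mod_cast hN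
  have hN4 : (0 : ℝ) < (N : ℝ) ^ 2 - 4 := by nlinarith
  have hNpos : (0 : ℝ) < N := by linarith
  set κw : ℝ := (N : ℝ) ^ 2 / (4 * ((N : ℝ) ^ 2 - 4)) with hκw
  set κt : ℝ := (N : ℝ) / (2 * ((N : ℝ) ^ 2 - 4)) with hκt
  set c : ℝ := 1 / (4 * (N : ℝ)) with hc
  have hκw0 : 0 ≤ κw := by positivity
  have hκt0 : 0 ≤ κt := by positivity
  have hc0 : 0 ≤ c := by positivity
  set Q : Matrix (Fin N) (Fin N) ℂ := (g : Matrix (Fin N) (Fin N) ℂ) with hQ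
  -- the five smooth cores
  have h1 := (contDiff_reTrCubic (N := N) B Δ B).add (contDiff_reTrCubic (N := N) B B Δ)
  have h3' := (contDiff_imTrMul (N := N) B).mul (contDiff_imTrQuad (N := N) Δ B)
  have h4 := contDiff_quad_eta (N := N) κt c B B Δ
  have h5 := contDiff_quad_eta (N := N) κt c Δ B B
  have h8 := contDiff_im_mul_imProd (N := N) B Δ
  have hG : (fun Q : Matrix (Fin N) (Fin N) ℂ =>
      κw / 2 *
          ((Q * B * Q * Δ * Q * B).trace.re + (Q * B * Q * B * Q * Δ).trace.re)
        + 2 * κw / N * (Q * B).trace.im * (Q * Δ * Q * B).trace.im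
        - 1 / 2 * ((Q * B * Q * B).trace *
            ((κt : ℂ) * (Q * Δ).trace
              - (c : ℂ) * (starRingEnd ℂ) (Q * Δ).trace)).re
        - 1 / 2 * ((Q * Δ * Q * B).trace *
            ((κt : ℂ) * (Q * B).trace
              - (c : ℂ) * (starRingEnd ℂ) (Q * B).trace)).re
        - 2 * κt / N *
          (Q * B).trace.im * ((Q * B).trace * (Q * Δ).trace).im) =
      fun Q : Matrix (Fin N) (Fin N) ℂ =>
        (κw / 2) * ((Q * B * Q * Δ * Q * B).trace.re + (Q * B * Q * B * Q * Δ).trace.re)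
        + (2 * κw / N) * ((Q * B).trace.im * (Q * Δ * Q * B).trace.im)
        + (-(1 / 2)) * ((Q * B * Q * B).trace * ((κt : ℂ) * (Q * Δ).trace - (c : ℂ) * (starRingEnd ℂ) (Q * Δ).trace)).re
        + (-(1 / 2)) * ((Q * Δ * Q * B).trace * ((κt : ℂ) * (Q * B).trace - (c : ℂ) * (starRingEnd ℂ) (Q * B).trace)).re
        + (-(2 * κt / N)) * ((Q * B).trace.im * ((Q * B).trace * (Q * Δ).trace).im) := by
    funext Q; ring
  have g1 : ContDiff ℝ ∞ fun Q : Matrix (Fin N) (Fin N) ℂ =>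
      (κw / 2) * ((Q * B * Q * Δ * Q * B).trace.re + (Q * B * Q * B * Q * Δ).trace.re) := contDiff_const.mul h1
  have g3 : ContDiff ℝ ∞ fun Q : Matrix (Fin N) (Fin N) ℂ =>
      (2 * κw / N) * ((Q * B).trace.im * (Q * Δ * Q * B).trace.im) := contDiff_const.mul h3'
  have g4 : ContDiff ℝ ∞ fun Q : Matrix (Fin N) (Fin N) ℂ => (-(1 / 2)) *
      ((Q * B * Q * B).trace * ((κt : ℂ) * (Q * Δ).trace - (c : ℂ) * (starRingEnd ℂ) (Q * Δ).trace)).re := contDiff_const.mul h4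
  have g5 : ContDiff ℝ ∞ fun Q : Matrix (Fin N) (Fin N) ℂ => (-(1 / 2)) *
      ((Q * Δ * Q * B).trace * ((κt : ℂ) * (Q * B).trace - (c : ℂ) * (starRingEnd ℂ) (Q * B).trace)).re := contDiff_const.mul h5
  have g8 : ContDiff ℝ ∞ fun Q : Matrix (Fin N) (Fin N) ℂ =>
      (-(2 * κt / N)) * ((Q * B).trace.im * ((Q * B).trace * (Q * Δ).trace).im) := contDiff_const.mul h8
  have s3 := g1.add g3
  have s4 := s3.add g4
  have s5 := s4.add g5
  rw [hG, matD_fun_add s5 g8, matD_fun_add s4 g5, matD_fun_add s3 g4, matD_fun_add g1 g3]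
  simp only []
  rw [matD_const_mul h1, matD_const_mul h3', matD_const_mul h4, matD_const_mul h5, matD_const_mul h8]
  simp only []
  -- the five term bounds
  have hA := frobNorm_nonneg A
  have hB0 := matrixOpNorm_nonneg B
  have hBF := frobNorm_nonneg B
  have hΔ := frobNorm_nonneg Δ
  have e1 : |matD A (fun Q : Matrix (Fin N) (Fin N) ℂ =>
      (Q * B * Q * Δ * Q * B).trace.re + (Q * B * Q * B * Q * Δ).trace.re) Q| ≤
      6 * matrixOpNorm B ^ 2 * frobNorm Δ * frobNorm A := by
    rw [matD_fun_add (contDiff_reTrCubic B Δ B) (contDiff_reTrCubic B B Δ)]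
    have t1 := abs_matD_reTrCubic_BDB_le A B Δ g
    have t2 := abs_matD_reTrCubic_BBD_le A B Δ g
    refine (abs_add_le _ _).trans ?_
    rw [← hQ] at t1 t2
    linarith
  have e3 := abs_matD_im_mul_imQuad_le A B Δ g
  have e4 : |matD A (fun Q : Matrix (Fin N) (Fin N) ℂ =>
      ((Q * B * Q * B).trace * ((κt : ℂ) * (Q * Δ).trace - (c : ℂ) * (starRingEnd ℂ) (Q * Δ).trace)).re) Q| ≤
      (κt + c) * (2 * matrixOpNorm B * frobNorm B * ‖(Q * Δ).trace‖ + ‖(Q * B * Q * B).trace‖ * frobNorm Δ) * frobNorm A := by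
    refine (abs_matD_quad_eta_le hκt0 hc0 A B B Δ g).trans ?_
    rw [← hQ]
    have hb := frobNorm_BgM_le B B g
    rw [← hQ] at hb
    have hκc : 0 ≤ κt + c := add_nonneg hκt0 hc0
    have : (frobNorm (B * Q * B) + frobNorm (B * Q * B)) * ‖(Q * Δ).trace‖ ≤
        2 * matrixOpNorm B * frobNorm B * ‖(Q * Δ).trace‖ := by nlinarith [norm_nonneg (Q * Δ).trace]
    exact mul_le_mul_of_nonneg_right (mul_le_mul_of_nonneg_left (by linarith) hκc) hA
  have e5 : |matD A (fun Q : Matrix (Fin N) (Fin N) ℂ =>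
      ((Q * Δ * Q * B).trace * ((κt : ℂ) * (Q * B).trace - (c : ℂ) * (starRingEnd ℂ) (Q * B).trace)).re) Q| ≤
      (κt + c) * (2 * matrixOpNorm B * frobNorm Δ * ‖(Q * B).trace‖ + ‖(Q * Δ * Q * B).trace‖ * frobNorm B) * frobNorm A := by
    refine (abs_matD_quad_eta_le hκt0 hc0 A Δ B B g).trans ?_
    rw [← hQ]
    have hb1 := frobNorm_MgB_le Δ B g
    have hb2 := frobNorm_BgM_le B Δ g
    rw [← hQ] at hb1 hb2
    have hκc : 0 ≤ κt + c := add_nonneg hκt0 hc0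
    have : (frobNorm (Δ * Q * B) + frobNorm (B * Q * Δ)) * ‖(Q * B).trace‖ ≤
        2 * matrixOpNorm B * frobNorm Δ * ‖(Q * B).trace‖ := by nlinarith [norm_nonneg (Q * B).trace]
    exact mul_le_mul_of_nonneg_right (mul_le_mul_of_nonneg_left (by linarith) hκc) hA
  have e8 := abs_matD_im_mul_imProd_le A B Δ g
  rw [← hQ] at e3 e8
  -- assemble
  have X0 := abs_nonneg (Q * B).trace.im
  have z10 := norm_nonneg (Q * B).trace
  have z20 := norm_nonneg (Q * Δ).trace
  have w0 := norm_nonneg (Q * Δ * Q * B).trace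
  have wBB0 := norm_nonneg (Q * B * Q * B).trace
  calc _ ≤ |κw / 2 * matD A (fun Q : Matrix (Fin N) (Fin N) ℂ =>
              (Q * B * Q * Δ * Q * B).trace.re + (Q * B * Q * B * Q * Δ).trace.re) Q|
          + |2 * κw / N * matD A (fun Q : Matrix (Fin N) (Fin N) ℂ => (Q * B).trace.im * (Q * Δ * Q * B).trace.im) Q|
          + |(-(1 / 2)) * matD A (fun Q : Matrix (Fin N) (Fin N) ℂ =>
              ((Q * B * Q * B).trace * ((κt : ℂ) * (Q * Δ).trace - (c : ℂ) * (starRingEnd ℂ) (Q * Δ).trace)).re) Q|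
          + |(-(1 / 2)) * matD A (fun Q : Matrix (Fin N) (Fin N) ℂ =>
              ((Q * Δ * Q * B).trace * ((κt : ℂ) * (Q * B).trace - (c : ℂ) * (starRingEnd ℂ) (Q * B).trace)).re) Q|
          + |(-(2 * κt / N)) * matD A (fun Q : Matrix (Fin N) (Fin N) ℂ =>
              (Q * B).trace.im * ((Q * B).trace * (Q * Δ).trace).im) Q| := by
        refine (abs_add_le _ _).trans ?_
        gcongr
        refine (abs_add_le _ _).trans ?_
        gcongr
        refine (abs_add_le _ _).trans ?_
        gcongr
        exact abs_add_le _ _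
    _ = κw / 2 * |matD A (fun Q : Matrix (Fin N) (Fin N) ℂ =>
              (Q * B * Q * Δ * Q * B).trace.re + (Q * B * Q * B * Q * Δ).trace.re) Q|
          + 2 * κw / N * |matD A (fun Q : Matrix (Fin N) (Fin N) ℂ => (Q * B).trace.im * (Q * Δ * Q * B).trace.im) Q|
          + 1 / 2 * |matD A (fun Q : Matrix (Fin N) (Fin N) ℂ =>
              ((Q * B * Q * B).trace * ((κt : ℂ) * (Q * Δ).trace - (c : ℂ) * (starRingEnd ℂ) (Q * Δ).trace)).re) Q|
          + 1 / 2 * |matD A (fun Q : Matrix (Fin N) (Fin N) ℂ =>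
              ((Q * Δ * Q * B).trace * ((κt : ℂ) * (Q * B).trace - (c : ℂ) * (starRingEnd ℂ) (Q * B).trace)).re) Q|
          + 2 * κt / N * |matD A (fun Q : Matrix (Fin N) (Fin N) ℂ =>
              (Q * B).trace.im * ((Q * B).trace * (Q * Δ).trace).im) Q| := by
        simp only [abs_mul, abs_neg, abs_of_nonneg (by positivity : (0 : ℝ) ≤ κw / 2),
          abs_of_nonneg (by positivity : (0 : ℝ) ≤ 2 * κw / N), abs_of_nonneg (by norm_num : (0 : ℝ) ≤ 1 / 2),
          abs_of_nonneg (by positivity : (0 : ℝ) ≤ 2 * κt / N)]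
    _ ≤ κw / 2 * (6 * matrixOpNorm B ^ 2 * frobNorm Δ * frobNorm A)
          + 2 * κw / N * ((2 * matrixOpNorm B * frobNorm Δ * |(Q * B).trace.im|
              + frobNorm B * ‖(Q * Δ * Q * B).trace‖) * frobNorm A)
          + 1 / 2 * ((κt + c) * (2 * matrixOpNorm B * frobNorm B * ‖(Q * Δ).trace‖ + ‖(Q * B * Q * B).trace‖ * frobNorm Δ)
              * frobNorm A)
          + 1 / 2 * ((κt + c) * (2 * matrixOpNorm B * frobNorm Δ * ‖(Q * B).trace‖ + ‖(Q * Δ * Q * B).trace‖ * frobNorm B)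
              * frobNorm A)
          + 2 * κt / N * ((|(Q * B).trace.im| * (frobNorm B * ‖(Q * Δ).trace‖ + frobNorm Δ * ‖(Q * B).trace‖)
              + frobNorm B * ‖(Q * B).trace‖ * ‖(Q * Δ).trace‖) * frobNorm A) := by
        gcongr
    _ = _ := by simp only [hc]; ring

/-- **`Γ(c₃', c₃')(g) ≤ P'(g)²` on `SU(N)`** for the five-term non-linear part of the cubic remainder, `N ≥ 3`. [folklore] -/
theorem Gam_c3prime_le (hN : 3 ≤ N) (B Δ : Matrix (Fin N) (Fin N) ℂ) (g : SUN N) :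
    Gam (fun Q : Matrix (Fin N) (Fin N) ℂ =>
      ((N : ℝ) ^ 2 / (4 * ((N : ℝ) ^ 2 - 4))) / 2 *
          ((Q * B * Q * Δ * Q * B).trace.re + (Q * B * Q * B * Q * Δ).trace.re)
        + 2 * ((N : ℝ) ^ 2 / (4 * ((N : ℝ) ^ 2 - 4))) / N * (Q * B).trace.im * (Q * Δ * Q * B).trace.im
        - 1 / 2 * ((Q * B * Q * B).trace *
            ((((N : ℝ) / (2 * ((N : ℝ) ^ 2 - 4)) : ℝ) : ℂ) * (Q * Δ).trace
              - ((1 / (4 * (N : ℝ)) : ℝ) : ℂ) * (starRingEnd ℂ) (Q * Δ).trace)).re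
        - 1 / 2 * ((Q * Δ * Q * B).trace *
            ((((N : ℝ) / (2 * ((N : ℝ) ^ 2 - 4)) : ℝ) : ℂ) * (Q * B).trace
              - ((1 / (4 * (N : ℝ)) : ℝ) : ℂ) * (starRingEnd ℂ) (Q * B).trace)).re
        - 2 * ((N : ℝ) / (2 * ((N : ℝ) ^ 2 - 4))) / N *
          (Q * B).trace.im * ((Q * B).trace * (Q * Δ).trace).im)
      (fun Q : Matrix (Fin N) (Fin N) ℂ =>
      ((N : ℝ) ^ 2 / (4 * ((N : ℝ) ^ 2 - 4))) / 2 *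
          ((Q * B * Q * Δ * Q * B).trace.re + (Q * B * Q * B * Q * Δ).trace.re)
        + 2 * ((N : ℝ) ^ 2 / (4 * ((N : ℝ) ^ 2 - 4))) / N * (Q * B).trace.im * (Q * Δ * Q * B).trace.im
        - 1 / 2 * ((Q * B * Q * B).trace *
            ((((N : ℝ) / (2 * ((N : ℝ) ^ 2 - 4)) : ℝ) : ℂ) * (Q * Δ).trace
              - ((1 / (4 * (N : ℝ)) : ℝ) : ℂ) * (starRingEnd ℂ) (Q * Δ).trace)).re
        - 1 / 2 * ((Q * Δ * Q * B).trace *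
            ((((N : ℝ) / (2 * ((N : ℝ) ^ 2 - 4)) : ℝ) : ℂ) * (Q * B).trace
              - ((1 / (4 * (N : ℝ)) : ℝ) : ℂ) * (starRingEnd ℂ) (Q * B).trace)).re
        - 2 * ((N : ℝ) / (2 * ((N : ℝ) ^ 2 - 4))) / N *
          (Q * B).trace.im * ((Q * B).trace * (Q * Δ).trace).im) g ≤
      (3 * ((N : ℝ) ^ 2 / (4 * ((N : ℝ) ^ 2 - 4))) * matrixOpNorm B ^ 2 * frobNorm Δ
        + 2 * ((N : ℝ) ^ 2 / (4 * ((N : ℝ) ^ 2 - 4))) / N *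
          (2 * matrixOpNorm B * frobNorm Δ * |((g : Matrix (Fin N) (Fin N) ℂ) * B).trace.im|
            + frobNorm B * ‖((g : Matrix (Fin N) (Fin N) ℂ) * Δ * g * B).trace‖)
        + 1 / 2 * (((N : ℝ) / (2 * ((N : ℝ) ^ 2 - 4))) + 1 / (4 * (N : ℝ))) *
          (2 * matrixOpNorm B * frobNorm B * ‖((g : Matrix (Fin N) (Fin N) ℂ) * Δ).trace‖
            + frobNorm Δ * ‖((g : Matrix (Fin N) (Fin N) ℂ) * B * g * B).trace‖)
        + 1 / 2 * (((N : ℝ) / (2 * ((N : ℝ) ^ 2 - 4))) + 1 / (4 * (N : ℝ))) *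
          (2 * matrixOpNorm B * frobNorm Δ * ‖((g : Matrix (Fin N) (Fin N) ℂ) * B).trace‖
            + frobNorm B * ‖((g : Matrix (Fin N) (Fin N) ℂ) * Δ * g * B).trace‖)
        + 2 * ((N : ℝ) / (2 * ((N : ℝ) ^ 2 - 4))) / N *
          (frobNorm B * |((g : Matrix (Fin N) (Fin N) ℂ) * B).trace.im| * ‖((g : Matrix (Fin N) (Fin N) ℂ) * Δ).trace‖
            + frobNorm Δ * |((g : Matrix (Fin N) (Fin N) ℂ) * B).trace.im| * ‖((g : Matrix (Fin N) (Fin N) ℂ) * B).trace‖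
            + frobNorm B * ‖((g : Matrix (Fin N) (Fin N) ℂ) * B).trace‖ * ‖((g : Matrix (Fin N) (Fin N) ℂ) * Δ).trace‖)) ^ 2 := by
  have hN0 : N ≠ 0 := by omega
  rw [Gam_self_eq_sum_sq]
  exact sum_sq_apply_frame_le hN0 (dirFun _ _) fun A => abs_matD_c3prime_le hN B Δ A g

/-! ### The split identity and the linear part -/

/-- **The split of the level-two decomposition on `SU(N)`**: `Δ_LB ψ₂ + NΓ(Re tr(·B), Re tr(·Δ)) + NΓ(Re tr(·B), ψ₂) =
(N − 1/N)/2 · Re tr(BΔᴴ) + Re tr(g·(N M_ℓ)) + N·c₃'(g)` — the hypothesis `hdec` of `cov_linear_le_of_poisson_split` with `ψ = ψ₂`,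
`c = c₃'`, `M = N M_ℓ`. [folklore] -/
theorem c3_split (hN : 3 ≤ N) (B Δ : Matrix (Fin N) (Fin N) ℂ) (g : SUN N) :
    Lap (fun Q : Matrix (Fin N) (Fin N) ℂ =>
        -((N : ℝ) ^ 2 / (4 * ((N : ℝ) ^ 2 - 4))) * (Q * Δ * Q * B).trace.re
          + ((N : ℝ) / (2 * ((N : ℝ) ^ 2 - 4))) * ((Q * B).trace * (Q * Δ).trace).re
          - (1 / (4 * (N : ℝ))) * ((Q * B).trace * (starRingEnd ℂ) (Q * Δ).trace).re) g
        + (N : ℝ) * Gam (pot 1 B) (pot 1 Δ) g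
        + (N : ℝ) * Gam (pot 1 B) (fun Q : Matrix (Fin N) (Fin N) ℂ =>
        -((N : ℝ) ^ 2 / (4 * ((N : ℝ) ^ 2 - 4))) * (Q * Δ * Q * B).trace.re
          + ((N : ℝ) / (2 * ((N : ℝ) ^ 2 - 4))) * ((Q * B).trace * (Q * Δ).trace).re
          - (1 / (4 * (N : ℝ))) * ((Q * B).trace * (starRingEnd ℂ) (Q * Δ).trace).re) g =
      (((N : ℝ) - 1 / N) / 2) * (B * Δᴴ).trace.re
        + pot 1 ((N : ℂ) • ((-((((N : ℝ) ^ 2 / (4 * ((N : ℝ) ^ 2 - 4))) / 2 : ℝ) : ℂ)) • (B * Bᴴ * Δ + Δ * Bᴴ * B)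
          + ((1 / 2 : ℝ) : ℂ) • (((((N : ℝ) / (2 * ((N : ℝ) ^ 2 - 4)) : ℝ) : ℂ) * (B * Bᴴ).trace - ((1 / (4 * (N : ℝ)) : ℝ) : ℂ) * (starRingEnd ℂ) (B * Bᴴ).trace) • Δ + ((((N : ℝ) / (2 * ((N : ℝ) ^ 2 - 4)) : ℝ) : ℂ) * (Δ * Bᴴ).trace - ((1 / (4 * (N : ℝ)) : ℝ) : ℂ) * (starRingEnd ℂ) (Δ * Bᴴ).trace) • B))) (g : Matrix (Fin N) (Fin N) ℂ)
        + (N : ℝ) * (fun Q : Matrix (Fin N) (Fin N) ℂ =>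
      ((N : ℝ) ^ 2 / (4 * ((N : ℝ) ^ 2 - 4))) / 2 *
          ((Q * B * Q * Δ * Q * B).trace.re + (Q * B * Q * B * Q * Δ).trace.re)
        + 2 * ((N : ℝ) ^ 2 / (4 * ((N : ℝ) ^ 2 - 4))) / N * (Q * B).trace.im * (Q * Δ * Q * B).trace.im
        - 1 / 2 * ((Q * B * Q * B).trace *
            ((((N : ℝ) / (2 * ((N : ℝ) ^ 2 - 4)) : ℝ) : ℂ) * (Q * Δ).trace
              - ((1 / (4 * (N : ℝ)) : ℝ) : ℂ) * (starRingEnd ℂ) (Q * Δ).trace)).re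
        - 1 / 2 * ((Q * Δ * Q * B).trace *
            ((((N : ℝ) / (2 * ((N : ℝ) ^ 2 - 4)) : ℝ) : ℂ) * (Q * B).trace
              - ((1 / (4 * (N : ℝ)) : ℝ) : ℂ) * (starRingEnd ℂ) (Q * B).trace)).re
        - 2 * ((N : ℝ) / (2 * ((N : ℝ) ^ 2 - 4))) / N *
          (Q * B).trace.im * ((Q * B).trace * (Q * Δ).trace).im) g := by
  have hN0 : N ≠ 0 := by omega
  have hlap := lap_psiTwo_add_gam hN B Δ g
  have hgam := gam_potB_psiTwo_eq hN B Δ g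
  rw [hgam]
  -- the linear statistic `pot 1 (N M_ℓ)` in coordinates
  set Q : Matrix (Fin N) (Fin N) ℂ := (g : Matrix (Fin N) (Fin N) ℂ) with hQ
  set η : ℂ := ((((N : ℝ) / (2 * ((N : ℝ) ^ 2 - 4)) : ℝ) : ℂ) * (B * Bᴴ).trace - ((1 / (4 * (N : ℝ)) : ℝ) : ℂ) * (starRingEnd ℂ) (B * Bᴴ).trace) with hη
  set α : ℂ := ((((N : ℝ) / (2 * ((N : ℝ) ^ 2 - 4)) : ℝ) : ℂ) * (Δ * Bᴴ).trace - ((1 / (4 * (N : ℝ)) : ℝ) : ℂ) * (starRingEnd ℂ) (Δ * Bᴴ).trace) with hα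
  have hpot : pot 1 ((N : ℂ) • ((-((((N : ℝ) ^ 2 / (4 * ((N : ℝ) ^ 2 - 4))) / 2 : ℝ) : ℂ)) • (B * Bᴴ * Δ + Δ * Bᴴ * B)
          + ((1 / 2 : ℝ) : ℂ) • (((((N : ℝ) / (2 * ((N : ℝ) ^ 2 - 4)) : ℝ) : ℂ) * (B * Bᴴ).trace - ((1 / (4 * (N : ℝ)) : ℝ) : ℂ) * (starRingEnd ℂ) (B * Bᴴ).trace) • Δ + ((((N : ℝ) / (2 * ((N : ℝ) ^ 2 - 4)) : ℝ) : ℂ) * (Δ * Bᴴ).trace - ((1 / (4 * (N : ℝ)) : ℝ) : ℂ) * (starRingEnd ℂ) (Δ * Bᴴ).trace) • B))) Q =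
      (N : ℝ) * (-(((N : ℝ) ^ 2 / (4 * ((N : ℝ) ^ 2 - 4))) / 2) * ((Q * (B * Bᴴ * Δ)).trace.re + (Q * (Δ * Bᴴ * B)).trace.re)
        + 1 / 2 * ((Q * Δ).trace * η).re + 1 / 2 * ((Q * B).trace * α).re) := by
    rw [← hη, ← hα]
    simp only [pot, one_mul, Matrix.mul_smul, Matrix.mul_add, smul_add, trace_smul, trace_add, smul_eq_mul,
      Complex.add_re, Complex.mul_re, Complex.ofReal_re, Complex.ofReal_im, Complex.natCast_re, Complex.natCast_im,
      Complex.neg_re, Complex.neg_im, zero_mul, sub_zero]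
    ring
  rw [hpot]
  simp only [hQ] at hlap ⊢
  linear_combination hlap

/-- **Frobenius norm of the linear part**: `‖N M_ℓ‖_F ≤ N ‖Δ‖_F (κ_w ‖B‖_op² + κ_t ‖B‖_F²)`, `N ≥ 3`. [folklore] -/
theorem frobNorm_linPart_le (hN : 3 ≤ N) (B Δ : Matrix (Fin N) (Fin N) ℂ) :
    frobNorm ((N : ℂ) • ((-((((N : ℝ) ^ 2 / (4 * ((N : ℝ) ^ 2 - 4))) / 2 : ℝ) : ℂ)) • (B * Bᴴ * Δ + Δ * Bᴴ * B)
          + ((1 / 2 : ℝ) : ℂ) • (((((N : ℝ) / (2 * ((N : ℝ) ^ 2 - 4)) : ℝ) : ℂ) * (B * Bᴴ).trace - ((1 / (4 * (N : ℝ)) : ℝ) : ℂ) * (starRingEnd ℂ) (B * Bᴴ).trace) • Δ + ((((N : ℝ) / (2 * ((N : ℝ) ^ 2 - 4)) : ℝ) : ℂ) * (Δ * Bᴴ).trace - ((1 / (4 * (N : ℝ)) : ℝ) : ℂ) * (starRingEnd ℂ) (Δ * Bᴴ).trace) • B))) ≤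
      (N : ℝ) * (frobNorm Δ * (((N : ℝ) ^ 2 / (4 * ((N : ℝ) ^ 2 - 4))) * matrixOpNorm B ^ 2
        + ((N : ℝ) / (2 * ((N : ℝ) ^ 2 - 4))) * frobNorm B ^ 2)) := by
  have hN0 : N ≠ 0 := by omega
  have h3 : (3 : ℝ) ≤ N := by exact_mod_cast hN
  have hN4 : (0 : ℝ) < (N : ℝ) ^ 2 - 4 := by nlinarith
  have hNpos : (0 : ℝ) < N := by linarith
  have hκw0 : 0 ≤ (N : ℝ) ^ 2 / (4 * ((N : ℝ) ^ 2 - 4)) := by positivity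
  have hκt0 : 0 ≤ (N : ℝ) / (2 * ((N : ℝ) ^ 2 - 4)) := by positivity
  have hc0 : 0 ≤ 1 / (4 * (N : ℝ)) := by positivity
  have hcκ : 1 / (4 * (N : ℝ)) ≤ (N : ℝ) / (2 * ((N : ℝ) ^ 2 - 4)) := by
    rw [div_le_div_iff₀ (by positivity) (by positivity)]
    nlinarith
  have hB0 := matrixOpNorm_nonneg B
  have hBF := frobNorm_nonneg B
  have hΔ := frobNorm_nonneg Δ
  -- the three pieces
  have p1 : frobNorm (B * Bᴴ * Δ + Δ * Bᴴ * B) ≤ 2 * matrixOpNorm B ^ 2 * frobNorm Δ := by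
    have a1 : frobNorm (B * Bᴴ * Δ) ≤ matrixOpNorm B ^ 2 * frobNorm Δ := by
      rw [Matrix.mul_assoc]
      refine (frobNorm_mul_le_matrixOpNorm_mul _ _).trans ?_
      have : frobNorm (Bᴴ * Δ) ≤ matrixOpNorm B * frobNorm Δ := by
        refine (frobNorm_mul_le_matrixOpNorm_mul _ _).trans ?_; rw [matrixOpNorm_conjTranspose]
      nlinarith [this, hB0]
    have a2 : frobNorm (Δ * Bᴴ * B) ≤ matrixOpNorm B ^ 2 * frobNorm Δ := by
      refine (frobNorm_mul_le_mul_matrixOpNorm _ _).trans ?_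
      have : frobNorm (Δ * Bᴴ) ≤ frobNorm Δ * matrixOpNorm B := by
        refine (frobNorm_mul_le_mul_matrixOpNorm _ _).trans ?_; rw [matrixOpNorm_conjTranspose]
      nlinarith [this, hB0]
    exact (frobNorm_add_le _ _).trans (by linarith)
  have p2 : frobNorm (((((N : ℝ) / (2 * ((N : ℝ) ^ 2 - 4)) : ℝ) : ℂ) * (B * Bᴴ).trace - ((1 / (4 * (N : ℝ)) : ℝ) : ℂ) * (starRingEnd ℂ) (B * Bᴴ).trace) • Δ) ≤
      ((N : ℝ) / (2 * ((N : ℝ) ^ 2 - 4)) - 1 / (4 * (N : ℝ))) * frobNorm B ^ 2 * frobNorm Δ := by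
    rw [frobNorm_smul, norm_eta_frob B hcκ]
  have p3 : frobNorm (((((N : ℝ) / (2 * ((N : ℝ) ^ 2 - 4)) : ℝ) : ℂ) * (Δ * Bᴴ).trace - ((1 / (4 * (N : ℝ)) : ℝ) : ℂ) * (starRingEnd ℂ) (Δ * Bᴴ).trace) • B) ≤
      ((N : ℝ) / (2 * ((N : ℝ) ^ 2 - 4)) + 1 / (4 * (N : ℝ))) * (frobNorm Δ * frobNorm B) * frobNorm B := by
    rw [frobNorm_smul]
    have hτ : ‖(Δ * Bᴴ).trace‖ ≤ frobNorm Δ * frobNorm B := by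
      have h := norm_trace_mul_le Δ Bᴴ; rwa [frobNorm_conjTranspose] at h
    have hη := (norm_kappa_sub_conj_le hκt0 hc0 (Δ * Bᴴ).trace).trans (mul_le_mul_of_nonneg_left hτ (add_nonneg hκt0 hc0))
    exact mul_le_mul_of_nonneg_right hη hBF
  have p23 := (frobNorm_add_le (((((N : ℝ) / (2 * ((N : ℝ) ^ 2 - 4)) : ℝ) : ℂ) * (B * Bᴴ).trace - ((1 / (4 * (N : ℝ)) : ℝ) : ℂ) * (starRingEnd ℂ) (B * Bᴴ).trace) • Δ) (((((N : ℝ) / (2 * ((N : ℝ) ^ 2 - 4)) : ℝ) : ℂ) * (Δ * Bᴴ).trace - ((1 / (4 * (N : ℝ)) : ℝ) : ℂ) * (starRingEnd ℂ) (Δ * Bᴴ).trace) • B)).trans (add_le_add p2 p3)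
  -- norms of the scalars
  have n0 : ‖(N : ℂ)‖ = N := Complex.norm_natCast N
  have n1 : ‖(-((((N : ℝ) ^ 2 / (4 * ((N : ℝ) ^ 2 - 4))) / 2 : ℝ) : ℂ))‖ = ((N : ℝ) ^ 2 / (4 * ((N : ℝ) ^ 2 - 4))) / 2 := by
    rw [norm_neg, Complex.norm_real, Real.norm_eq_abs, abs_of_nonneg (by positivity)]
  have n2 : ‖((1 / 2 : ℝ) : ℂ)‖ = 1 / 2 := by
    rw [Complex.norm_real, Real.norm_eq_abs, abs_of_nonneg (by norm_num)]
  rw [frobNorm_smul, n0]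
  refine mul_le_mul_of_nonneg_left ?_ hNpos.le
  refine (frobNorm_add_le _ _).trans ?_
  rw [frobNorm_smul, frobNorm_smul, n1, n2]
  nlinarith [p1, p23, hκw0, hBF, hΔ, hB0, mul_nonneg hBF hΔ, mul_nonneg (mul_nonneg hBF hBF) hΔ]

end Calc

end Summit.Ventures.YMGap.OneLinkEigen
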